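import Summits.BirchSwinnertonDyer.BirchSwinnertonDyer.Theorems.ThetaPartnerAtTwoSignedControlAtTwoShaTwoReadoutRoadReal
import Summits.BirchSwinnertonDyer.BirchSwinnertonDyer.Theorems.CumulativeHeegnerLeopoldtRedSplitControlAtThreeShaTwoNativeAssembly
import Summits.BirchSwinnertonDyer.BirchSwinnertonDyer.Theorems.ThetaPartnerAtTwoSignedControlAtTwoShaTwoPrimaryFinite
import HarnessLib

/-!
# Poitou–Tate, degree two, at fields WITH REAL PLACES: `poitouTate_sha_tateDual K` for EVERY number field from the
# doors' degree-`≤ 1` package and Milne I Lemma 4.13 in the forms (A), (B) — and the K4 stub over `ℚ`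

Crux K4 `SignedControlAtTwo` (stmt-BirchSwinnertonDyer-20309; routes `ThetaPartnerAtTwo` / `ResidualThetaTransportAtTwo`), line
`eulerchar` v13 (lead `bsd-wall-tp2-p3` g5), registered stub `stub_poitouTateShaRat : poitouTate_sha_tateDual ℚ`; seat
`bsd-inputs-k4-p1` (`--supports stmt-BirchSwinnertonDyer-20309`, helper; CONDITIONAL).  Sequel of
`…ShaTwoReadoutRoadReal` (`shaTwo_tateDual_of_ideleProjection_real`: the `Ш²`-readout road of seat `bsd-line-chl-p2` without
`IsTotallyComplex`).  This file re-runs chl-p2 g7's native assembly (`…RedSplitControlAtThreeShaTwoNativeAssembly`: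
`Ψ := HomDual.shaTwoConnecting ρ₀ n hM`, properties (a)–(d) PROVED there at every place, (e) ⟸ (A) ∧ (B) by
`HomDual.exists_shaTwoConnecting_eq_of_localGlobal`) for an ARBITRARY number field `K`:

* `map_mem_shaTwo_real`, `nonempty_shaTwo_addEquiv_real` — `H²(f)` carries `Ш²(K, M₁)` into `Ш²(K, M₂)` and
  `Ш²(K, M₁) ≃ Ш²(K, M₂)` along an isomorphism of Galois modules, ANY `K` (chl-p2 g6's `map_mem_shaTwo` used `H² = 0` at the
  complex places; here naturality of localisation at the infinite places, `SignedEC.ShaTwo.localization_inl_map_two`);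
* `shaTwo_tateDual_of_shaTwoConnecting_real` — road B with the native `Ψ` plugged in, any `K`;
* **`poitouTate_sha_tateDual_of_shaTwoConnecting_real`** — THE NAMED FACT `poitouTate_sha_tateDual K` for ANY number field
  from {`SelmerComplement` of the canonical invariant maps at all levels (= `hE`, cell `bsd-schneider` door-c4), the Tate
  duality record for `(Γ_K, C̄, inv)` (door-c4, landed), ONE family `π` of idèle projections with (R3) (door-c5), the bridge
  `nat` with the (R4) identity in equality form — archimedean summands included —, and (e) `Ш²(K, M₀^D) ⊆ Im Ψ'`};
* **`poitouTate_sha_tateDual_of_localGlobal_real`** — the same with (e) replaced by the two classical local–global statements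
  (A) (Brauer–Hasse–Noether for `K(M₀)` + Shapiro: the class `H²(p^*)(H²(e) c)` of `c ∈ Ш²(K, M₀^D)` vanishes in
  `H²(K, Hom_ℤ(P, K̄ˣ))`) and (B) (Milne I 4.13 in degree `1` for the relation lattice: a class of `H¹(K, Hom_ℤ(N₁, K̄ˣ))` whose
  transfers to all completions vanish dies in `H¹(K, Hom_ℤ(N₁, J̄))`; cell `bsd-schneider` door-c5 g18);
* **`SignedEC.PoitouTateShaRat.poitouTate_sha_tateDual_rat_of_localGlobal`** — the K4 stub fact `poitouTate_sha_tateDual ℚ`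
  BY NAME from exactly those inputs at `K = ℚ`: the registered stub `stub_poitouTateShaRat` closes by
  `poitouTate_sha_tateDual_rat_of_localGlobal hcomp inv hT π hR3 hR4 hA hB` the moment the named bricks land for `ℚ`.

HONEST FRAMING. THEOREMS ONLY (no definition, no named fact, no `sorry`); a reduction — `SelmerComplement` (= `hE`), (R3),
`nat`/(R4), (A), (B) are displayed hypotheses on existing objects (being landed by cells `bsd-schneider` / `bsd-wall`); closes
no item; no case of Poitou–Tate or BSD is proved here.

References: [MilneADT2006] I Thm. 4.10 (a) and its proof (p. 58), Thm. 2.13 (a), Lemma 4.8, Lemma 4.13, Prop. 0.19;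
[Harari2020] Thm. 17.13 (b); [CasselsFrohlichANT1967] Ch. VII §9.6, §10, §11.1; [SerreAbelianLadic1968] Ch. I §2.1.
-/

noncomputable section

open Function NumberField IsDedekindDomain CategoryTheory CategoryTheory.Abelian
open scoped NumberField ContRepresentation

set_option linter.dupNamespace false
set_option autoImplicit false

namespace Summit.BirchSwinnertonDyer.BirchSwinnertonDyer.Theorems.PoitouTateShaTwoReadout

open Field
open Literature.NumberTheory.GaloisRepresentations Literature.NumberTheory.GaloisCohomology
open Literature.NumberTheory.GaloisRepresentations.DiscreteGaloisModule (TateDual tateDual localTatePairingZMod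
  unramifiedSubgroup sha shaTwo SelmerStructure mem_sha_iff mem_shaTwo_iff)
open Literature.Algebra.Homology Literature.Algebra.Homology.DiscreteRep Literature.Algebra.Homology.ExtPresentation
open Literature.NumberTheory.GaloisRepresentations.IdeleClassBar (classBarD)
open Literature.AnabelianGeometry.AbsoluteAnabelian.Prop121vii (zmodToQmodZ)
open Literature.NumberTheory.GaloisRepresentations.FreePresentation (presentationComplex presentationComplex_shortExact)
open Literature.NumberTheory.GaloisRepresentations.HomDual (IdeleProjection readout shaTwoConnecting shaTwoConnecting_comp_g'
  shaTwoConnecting_f_comp exists_comp_g_eq_of_shaTwoConnecting_eq_zero shaTwoConnecting_mem_shaTwo)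
open Summit.BirchSwinnertonDyer.BirchSwinnertonDyer.Theorems.SchneiderFreeAdditiveX3.PoitouTateReduction
  (exists_bidual_intertwining)
open Summit.BirchSwinnertonDyer.BirchSwinnertonDyer.Theorems.SignedEC.MuReal (exists_finset_place_isUnramifiedAt)
open Summit.BirchSwinnertonDyer.Rank1Residual.X11b

/-! ## §1 Transport of `Ш²` along isomorphisms of Galois modules, any number field -/

section Transport

variable {K : Type} [Field K] [NumberField K]
  {M₁ M₂ : Type} [AddCommGroup M₁] [TopologicalSpace M₁] [DiscreteTopology M₁]
  [AddCommGroup M₂] [TopologicalSpace M₂] [DiscreteTopology M₂]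
  {ρ₁ : DiscreteGaloisModule K M₁} {ρ₂ : DiscreteGaloisModule K M₂}

/-- **`H²(f)` carries `Ш²(K, M₁)` into `Ш²(K, M₂)`**, ANY number field: naturality of localisation at the finite places
(`WeakLeopoldt.localization_inr_map_two`) AND at the infinite places (`SignedEC.ShaTwo.localization_inl_map_two`).
Any-`K` version of chl-p2 g6's `map_mem_shaTwo` (which used `H² = 0` at complex places).
[cite: MilneADT2006, Ch. I §4 (definition of `Ш²`)] -/
theorem map_mem_shaTwo_real (f : ρ₁.toContRepresentation →ⁱL ρ₂.toContRepresentation)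
    {x : galoisCohomology ρ₁ 2} (hx : x ∈ shaTwo ρ₁) : galoisCohomology.map f 2 x ∈ shaTwo ρ₂ := by
  rw [mem_shaTwo_iff] at hx ⊢
  rintro (w | v)
  · rw [SignedEC.ShaTwo.localization_inl_map_two, hx (Sum.inl w)]
    exact map_zero _
  · rw [WeakLeopoldt.localization_inr_map_two, hx (Sum.inr v)]
    exact map_zero _

/-- **`Ш²(K, M₁) ≃ Ш²(K, M₂)` along an isomorphism `M₁ ≅ M₂` of Galois modules**, ANY number field.
[cite: MilneADT2006, Ch. I §4] -/
theorem nonempty_shaTwo_addEquiv_real (f : ρ₁.toContRepresentation →ⁱL ρ₂.toContRepresentation)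
    (g : ρ₂.toContRepresentation →ⁱL ρ₁.toContRepresentation) (hgf : ∀ a : M₁, g (f a) = a)
    (hfg : ∀ b : M₂, f (g b) = b) : Nonempty (shaTwo ρ₁ ≃+ shaTwo ρ₂) :=
  ⟨{ toFun := fun c => ⟨galoisCohomology.map f 2 c, map_mem_shaTwo_real f c.2⟩
     invFun := fun c => ⟨galoisCohomology.map g 2 c, map_mem_shaTwo_real g c.2⟩
     left_inv := fun c => Subtype.ext (map_map_eq_self_of_comp_eq_two f g hgf c)
     right_inv := fun c => Subtype.ext (map_map_eq_self_of_comp_eq_two g f hfg c)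
     map_add' := fun _ _ => Subtype.ext (map_add _ _ _) }⟩

end Transport

/-! ## §2 Road B with the NATIVE `Ψ := shaTwoConnecting` plugged in, any number field -/

section Plugged

variable {K : Type} [Field K] [NumberField K]

/-- **Milne I Thm. 4.10 (a) at the module `M₀^D`, from the presentation road with the NATIVE obstruction map plugged in —
ANY number field.**  For `n ≥ 1`, a finite `n`-torsion `ρ₀` on `M₀`: IF Tate duality holds for `(Γ_K, C̄, inv)` (door-c4,
landed), a family `π` of idèle projections has the (R3) property for the idèle readout (all places), a bijection
`nat : H¹(K, M₀^{DD}) ≅ Ext¹(ℤ, M₀)` satisfies the (R4) identity (archimedean summands included), the canonical invariant maps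
satisfy `SelmerComplement` at level `n`, and (e) the native obstruction map `Ψ' = shaTwoConnecting ρ₀ n hM` EXHAUSTS `Ш²(K, M₀^D)`,
THEN `Ш²(K, M₀^D)` is finite and perfectly paired with `Ш¹(K, M₀^{DD})` into `ℤ/n`.  Properties (a)(b)(c)(d) of `Ψ'` are theorems
(`HomDualShaTwoConnecting`; (d) at every place), the ramification set `S₀` and the finiteness of `Ш¹` are produced inside.
Verbatim chl-p2 g7's `shaTwo_tateDual_of_shaTwoConnecting` minus `[IsTotallyComplex K]`.  HONEST FRAMING: a reduction; closes nothing.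
[cite: MilneADT2006, Ch. I, Thm. 4.10 (a) (proof, p. 58), Thm. 2.13 (a), Lemma 4.8, Lemma 4.13][cite: Harari2020, Thm. 17.13 (b)] -/
theorem shaTwo_tateDual_of_shaTwoConnecting_real {n : ℕ} [NeZero n]
    (hcomp : (LocalInvariants.canonical K n).SelmerComplement)
    (inv : Abelian.Ext (triv (Γ := absoluteGaloisGroup K) ℤ) (classBarD K) 2 →+ AddCircle (1 : ℚ))
    (hT : TateDualityHypotheses (classBarD K) inv) (π : ∀ v : Place K, IdeleProjection K v)
    {M : Type} [AddCommGroup M] [TopologicalSpace M] [DiscreteTopology M] [Finite M] [Finite (TateDual K M n)]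
    (ρ₀ : DiscreteGaloisModule K M) (hM : ∀ m : M, n • m = 0)
    (hR3 : ∀ T : Finset (Place K), (∀ w : InfinitePlace K, (Sum.inl w : Place K) ∈ T) →
      (∀ v : HeightOneSpectrum (𝓞 K), (Sum.inr v : Place K) ∉ T →
        ((n : ℕ) : 𝓞 K) ∉ v.asIdeal ∧ GaloisRep.IsUnramifiedAt v (ρ₀.tateDual n)) →
      ∀ t : Π v : Place K, galoisCohomology ((ρ₀.tateDual n).toLocal v) 1,
        (∀ v : HeightOneSpectrum (𝓞 K), (Sum.inr v : Place K) ∉ T →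
          t (Sum.inr v) ∈ unramifiedSubgroup (GaloisRep.toLocal v (ρ₀.tateDual n)) 1) →
        ∃ f : (presentationComplex ρ₀).X₁ ⟶ (ideleClassLimitShortComplex K).X₂,
          ∀ v : Place K, readout ρ₀ n hM (π v) f = t v)
    (nat : galoisCohomology ((ρ₀.tateDual n).tateDual n) 1 →+
      Abelian.Ext (triv (Γ := absoluteGaloisGroup K) ℤ) (presentationComplex ρ₀).X₃ 1)
    (hnat : Function.Bijective nat)
    (hR4 : ∀ f : (presentationComplex ρ₀).X₁ ⟶ (ideleClassLimitShortComplex K).X₂, ∃ Tf : Finset (Place K),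
      ∀ (y : galoisCohomology ((ρ₀.tateDual n).tateDual n) 1) (T' : Finset (Place K)), Tf ⊆ T' →
        (∀ v : HeightOneSpectrum (𝓞 K), (Sum.inr v : Place K) ∉ T' →
          galoisCohomology.localization ((ρ₀.tateDual n).tateDual n) (Sum.inr v) 1 y ∈
            unramifiedSubgroup (GaloisRep.toLocal v ((ρ₀.tateDual n).tateDual n)) 1) →
        zmodToQmodZ n (∑ v ∈ T', localTatePairingZMod (ρ₀.tateDual n) n v (LocalInvariants.canonical K n v)
          (readout ρ₀ n hM (π v) f)
          (galoisCohomology.localization ((ρ₀.tateDual n).tateDual n) v 1 y)) =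
        inv ((nat y).comp (boundary (presentationComplex_shortExact ρ₀) (classBarD K)
          (f ≫ (ideleClassLimitShortComplex K).g)) (rfl : 1 + 1 = 2)))
    (hΨsurj : ∀ c ∈ shaTwo (ρ₀.tateDual n), ∃ h : (presentationComplex ρ₀).X₁ ⟶ classBarD K,
      shaTwoConnecting ρ₀ n hM h = c) :
    Finite (shaTwo (ρ₀.tateDual n)) ∧
      ∃ b : shaTwo (ρ₀.tateDual n) →+ sha ((ρ₀.tateDual n).tateDual n) →+ ZMod n,
        Function.Bijective b ∧ Function.Bijective b.flip := by
  haveI : Finite (TateDual K (TateDual K M n) n) := DiscreteGaloisModule.TateDual.finite K _ n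
  -- the ramification set of `M₀^D` and the finiteness of `Ш¹(K, M₀^{DD})` are theorems
  obtain ⟨S₀, hinf, hS₀⟩ := exists_finset_place_isUnramifiedAt (ρ₀.tateDual n) n
  obtain ⟨S₁, hinf₁, hS₁⟩ := exists_finset_place_isUnramifiedAt ((ρ₀.tateDual n).tateDual n) n
  haveI : Finite (sha ((ρ₀.tateDual n).tateDual n)) :=
    finite_sha_of_isUnramifiedOutside _ S₁ hinf₁ fun v hv => (hS₁ v hv).2
  exact shaTwo_tateDual_of_ideleProjection_real hcomp inv hT π ρ₀ hM S₀ hinf hS₀ hR3 nat hnat hR4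
    (shaTwoConnecting ρ₀ n hM) (fun f => shaTwoConnecting_comp_g' ρ₀ n hM f) (shaTwoConnecting_f_comp ρ₀ n hM)
    (exists_comp_g_eq_of_shaTwoConnecting_eq_zero ρ₀ n hM) (shaTwoConnecting_mem_shaTwo ρ₀ n hM π) hΨsurj

end Plugged

/-! ## §3 The named fact `poitouTate_sha_tateDual K`, any number field -/

section Assembly

variable {K : Type} [Field K] [NumberField K]

/-- **THE NAMED FACT `poitouTate_sha_tateDual K` (Milne I Thm. 4.10 (a): `Ш²(K, M)` and `Ш¹(K, M^D)` finite and perfectly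
paired into `ℤ/n`, all `n ≥ 1`, all finite `n`-torsion `M`) for ANY number field `K` — real places allowed, `K = ℚ` is K4 —,
from the presentation road of cell `bsd-schneider` plus the NATIVE degree-`2` obstruction map.**  Inputs, each quantified
over all levels `n ≥ 1` and all finite `n`-torsion modules `M₀`: `SelmerComplement` of the canonical invariant maps (= `hE(n)`);
Tate duality for `(Γ_K, C̄, inv)` (door-c4, landed for `inv = classBarInvD K`); ONE family `π` of idèle projections with the
(R3) property for the idèle readout of the canonical presentation; the bridge `nat` with the (R4) identity (archimedean
summands included); and (e) `Ш²(K, M₀^D) ⊆ Im (shaTwoConnecting ρ₀ n hM)`.  The pairing for `M` is transported from the road's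
pairing for `(Ш²(K, M^{DD}), Ш¹(K, M^{DDD}))` along the biduality `M ≅ M^{DD}` (`nonempty_shaTwo_addEquiv_real`).  Verbatim
chl-p2 g7's `poitouTate_sha_tateDual_of_shaTwoConnecting` minus `[IsTotallyComplex K]`.  HONEST FRAMING: a reduction with
displayed hypotheses; no case of BSD.
[cite: MilneADT2006, Ch. I, Thm. 4.10 (a) (proof, p. 58), Thm. 2.13 (a), Lemma 4.8, Prop. 0.19][cite: Harari2020, Thm. 17.13 (b)] -/
theorem poitouTate_sha_tateDual_of_shaTwoConnecting_real
    (hcomp : ∀ (n : ℕ) [NeZero n], (LocalInvariants.canonical K n).SelmerComplement)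
    (inv : Abelian.Ext (triv (Γ := absoluteGaloisGroup K) ℤ) (classBarD K) 2 →+ AddCircle (1 : ℚ))
    (hT : TateDualityHypotheses (classBarD K) inv) (π : ∀ v : Place K, IdeleProjection K v)
    (hR3 : ∀ (n : ℕ) [NeZero n],
      ∀ ⦃M : Type⦄ [AddCommGroup M] [TopologicalSpace M] [DiscreteTopology M] [Finite M] [Finite (TateDual K M n)]
      (ρ₀ : DiscreteGaloisModule K M) (hM : ∀ m : M, n • m = 0),
      ∀ T : Finset (Place K), (∀ w : InfinitePlace K, (Sum.inl w : Place K) ∈ T) →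
        (∀ v : HeightOneSpectrum (𝓞 K), (Sum.inr v : Place K) ∉ T →
          ((n : ℕ) : 𝓞 K) ∉ v.asIdeal ∧ GaloisRep.IsUnramifiedAt v (ρ₀.tateDual n)) →
        ∀ t : Π v : Place K, galoisCohomology ((ρ₀.tateDual n).toLocal v) 1,
          (∀ v : HeightOneSpectrum (𝓞 K), (Sum.inr v : Place K) ∉ T →
            t (Sum.inr v) ∈ unramifiedSubgroup (GaloisRep.toLocal v (ρ₀.tateDual n)) 1) →
          ∃ f : (presentationComplex ρ₀).X₁ ⟶ (ideleClassLimitShortComplex K).X₂,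
            ∀ v : Place K, readout ρ₀ n hM (π v) f = t v)
    (hR4 : ∀ (n : ℕ) [NeZero n],
      ∀ ⦃M : Type⦄ [AddCommGroup M] [TopologicalSpace M] [DiscreteTopology M] [Finite M] [Finite (TateDual K M n)]
      (ρ₀ : DiscreteGaloisModule K M) (hM : ∀ m : M, n • m = 0),
      ∃ nat : galoisCohomology ((ρ₀.tateDual n).tateDual n) 1 →+
          Abelian.Ext (triv (Γ := absoluteGaloisGroup K) ℤ) (presentationComplex ρ₀).X₃ 1,
        Function.Bijective nat ∧
        ∀ f : (presentationComplex ρ₀).X₁ ⟶ (ideleClassLimitShortComplex K).X₂, ∃ Tf : Finset (Place K),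
          ∀ (y : galoisCohomology ((ρ₀.tateDual n).tateDual n) 1) (T' : Finset (Place K)), Tf ⊆ T' →
            (∀ v : HeightOneSpectrum (𝓞 K), (Sum.inr v : Place K) ∉ T' →
              galoisCohomology.localization ((ρ₀.tateDual n).tateDual n) (Sum.inr v) 1 y ∈
                unramifiedSubgroup (GaloisRep.toLocal v ((ρ₀.tateDual n).tateDual n)) 1) →
            zmodToQmodZ n (∑ v ∈ T', localTatePairingZMod (ρ₀.tateDual n) n v (LocalInvariants.canonical K n v)
              (readout ρ₀ n hM (π v) f)
              (galoisCohomology.localization ((ρ₀.tateDual n).tateDual n) v 1 y)) =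
            inv ((nat y).comp (boundary (presentationComplex_shortExact ρ₀) (classBarD K)
              (f ≫ (ideleClassLimitShortComplex K).g)) (rfl : 1 + 1 = 2)))
    (hΨsurj : ∀ (n : ℕ) [NeZero n],
      ∀ ⦃M : Type⦄ [AddCommGroup M] [TopologicalSpace M] [DiscreteTopology M] [Finite M]
      (ρ₀ : DiscreteGaloisModule K M) (hM : ∀ m : M, n • m = 0),
        ∀ c ∈ shaTwo (ρ₀.tateDual n), ∃ h : (presentationComplex ρ₀).X₁ ⟶ classBarD K,
          shaTwoConnecting ρ₀ n hM h = c) :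
    poitouTate_sha_tateDual K := by
  intro n _ M _ _ _ _ ρ hM
  haveI : Finite (TateDual K M n) := DiscreteGaloisModule.TateDual.finite K M n
  haveI : Finite (TateDual K (TateDual K M n) n) := DiscreteGaloisModule.TateDual.finite K _ n
  haveI : Finite (TateDual K (TateDual K (TateDual K M n) n) n) := DiscreteGaloisModule.TateDual.finite K _ n
  -- the module to present: `ρ₀ := ρ^D`, so that the road speaks about `Ш²(ρ^{DD})` and `Ш¹(ρ^{DDD})`
  set ρ₀ : DiscreteGaloisModule K (TateDual K M n) := ρ.tateDual n with hρ₀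
  have hM₀ : ∀ m : TateDual K M n, n • m = 0 := fun m => DiscreteGaloisModule.TateDual.nsmul_eq_zero m
  -- finiteness of `Ш¹(K, M^D)`
  obtain ⟨S₂, hinf₂, hS₂⟩ := exists_finset_place_isUnramifiedAt (ρ.tateDual n) n
  haveI hfin1 : Finite (sha (ρ.tateDual n)) :=
    finite_sha_of_isUnramifiedOutside _ S₂ hinf₂ fun v hv => (hS₂ v hv).2
  -- the road at `ρ₀`
  obtain ⟨nat, hnat, hR4'⟩ := hR4 n ρ₀ hM₀
  obtain ⟨hfin2', b, hb, hbflip⟩ := shaTwo_tateDual_of_shaTwoConnecting_real (hcomp n) inv hT π ρ₀ hM₀ (hR3 n ρ₀ hM₀)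
    nat hnat hR4' (hΨsurj n ρ₀ hM₀)
  -- biduality `M ≅ M^{DD}` and `M^D ≅ M^{DDD}`
  obtain ⟨ι, κ, -, hκι, hικ⟩ := exists_bidual_intertwining (n := n) ρ hM
  obtain ⟨ι', κ', -, hκι', hικ'⟩ := exists_bidual_intertwining (n := n) (ρ.tateDual n) hM₀
  obtain ⟨eA⟩ : Nonempty (shaTwo ρ ≃+ shaTwo (ρ₀.tateDual n)) := nonempty_shaTwo_addEquiv_real ι κ hκι hικ
  obtain ⟨eB⟩ : Nonempty (sha (ρ.tateDual n) ≃+ sha ((ρ₀.tateDual n).tateDual n)) :=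
    nonempty_sha_addEquiv ι' κ' hκι' hικ'
  haveI := hfin2'
  obtain ⟨b', -, hb', hb'flip⟩ := exists_perfect_of_addEquiv eA eB b hb hbflip
  exact ⟨hfin1, Finite.of_equiv _ eA.toEquiv.symm, b', hb', hb'flip⟩

end Assembly

/-! ## §4 `poitouTate_sha_tateDual K` from the doors' package and Milne I Lemma 4.13 in the forms (A), (B), any number field -/

section LocalGlobal

variable {K : Type} [Field K] [NumberField K]

open Literature.NumberTheory.GaloisRepresentations.HomDual (exists_shaTwoConnecting_eq_of_localGlobal dualF homF postcompResHom
  unitsTransfer unitsToIdeleI)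
open Literature.NumberTheory.GaloisRepresentations.FreePresentation (presModule₁ presModule₂ presProj moduleFinite_presModule₁
  moduleFinite_presModule₂)
open Literature.NumberTheory.GaloisRepresentations.DGMBridge (toDGM)
open Literature.NumberTheory.GaloisRepresentations.DiscreteGaloisModule (units)

/-- **THE NAMED FACT `poitouTate_sha_tateDual K` for ANY number field `K` (real places allowed; `K = ℚ` is K4), with (e)
replaced by Milne I Lemma 4.13 in the two Lean-typed forms (A), (B) of `HomDual.exists_shaTwoConnecting_eq_of_localGlobal`.**
Inputs, over all levels `n ≥ 1` and all finite `n`-torsion `M₀`: `SelmerComplement` of the canonical invariant maps (= `hE`),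
the Tate duality record for `(Γ_K, C̄, inv)` (landed), ONE family `π` of idèle projections with (R3), the bridge `nat` with
(R4) (archimedean summands included), and
(A) for `c ∈ Ш²(K, M₀^D)` the class `H²(p^*)(H²(e) c) ∈ H²(K, Hom_ℤ(P, K̄ˣ))` vanishes (local–global principle for
`H²(K, Hom(P, K̄ˣ)) ≅ Br(K(M₀))^{|M₀|}`: Brauer–Hasse–Noether + Shapiro), (B) a class of `H¹(K, Hom_ℤ(N₁, K̄ˣ))` whose transfers
to all completions vanish dies in `H¹(K, Hom_ℤ(N₁, J̄))` (Milne I 4.13 in degree `1` for the relation lattice).  Verbatim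
chl-p2 g7's `poitouTate_sha_tateDual_of_localGlobal` minus `[IsTotallyComplex K]`.  HONEST FRAMING: a reduction; (A), (B),
(R3), (R4), `SelmerComplement` are displayed hypotheses; no case of BSD.
[cite: MilneADT2006, Ch. I, Thm. 4.10 (a) (proof, p. 58), Thm. 2.13 (a), Lemma 4.13, Lemma 4.8]
[cite: CasselsFrohlichANT1967, Ch. VII §9.6, §10, §11.1][cite: Harari2020, Thm. 17.13 (b)] -/
theorem poitouTate_sha_tateDual_of_localGlobal_real
    (hcomp : ∀ (n : ℕ) [NeZero n], (LocalInvariants.canonical K n).SelmerComplement)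
    (inv : Abelian.Ext (triv (Γ := absoluteGaloisGroup K) ℤ) (classBarD K) 2 →+ AddCircle (1 : ℚ))
    (hT : TateDualityHypotheses (classBarD K) inv) (π : ∀ v : Place K, IdeleProjection K v)
    (hR3 : ∀ (n : ℕ) [NeZero n],
      ∀ ⦃M : Type⦄ [AddCommGroup M] [TopologicalSpace M] [DiscreteTopology M] [Finite M] [Finite (TateDual K M n)]
      (ρ₀ : DiscreteGaloisModule K M) (hM : ∀ m : M, n • m = 0),
      ∀ T : Finset (Place K), (∀ w : InfinitePlace K, (Sum.inl w : Place K) ∈ T) →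
        (∀ v : HeightOneSpectrum (𝓞 K), (Sum.inr v : Place K) ∉ T →
          ((n : ℕ) : 𝓞 K) ∉ v.asIdeal ∧ GaloisRep.IsUnramifiedAt v (ρ₀.tateDual n)) →
        ∀ t : Π v : Place K, galoisCohomology ((ρ₀.tateDual n).toLocal v) 1,
          (∀ v : HeightOneSpectrum (𝓞 K), (Sum.inr v : Place K) ∉ T →
            t (Sum.inr v) ∈ unramifiedSubgroup (GaloisRep.toLocal v (ρ₀.tateDual n)) 1) →
          ∃ f : (presentationComplex ρ₀).X₁ ⟶ (ideleClassLimitShortComplex K).X₂,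
            ∀ v : Place K, readout ρ₀ n hM (π v) f = t v)
    (hR4 : ∀ (n : ℕ) [NeZero n],
      ∀ ⦃M : Type⦄ [AddCommGroup M] [TopologicalSpace M] [DiscreteTopology M] [Finite M] [Finite (TateDual K M n)]
      (ρ₀ : DiscreteGaloisModule K M) (hM : ∀ m : M, n • m = 0),
      ∃ nat : galoisCohomology ((ρ₀.tateDual n).tateDual n) 1 →+
          Abelian.Ext (triv (Γ := absoluteGaloisGroup K) ℤ) (presentationComplex ρ₀).X₃ 1,
        Function.Bijective nat ∧
        ∀ f : (presentationComplex ρ₀).X₁ ⟶ (ideleClassLimitShortComplex K).X₂, ∃ Tf : Finset (Place K),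
          ∀ (y : galoisCohomology ((ρ₀.tateDual n).tateDual n) 1) (T' : Finset (Place K)), Tf ⊆ T' →
            (∀ v : HeightOneSpectrum (𝓞 K), (Sum.inr v : Place K) ∉ T' →
              galoisCohomology.localization ((ρ₀.tateDual n).tateDual n) (Sum.inr v) 1 y ∈
                unramifiedSubgroup (GaloisRep.toLocal v ((ρ₀.tateDual n).tateDual n)) 1) →
            zmodToQmodZ n (∑ v ∈ T', localTatePairingZMod (ρ₀.tateDual n) n v (LocalInvariants.canonical K n v)
              (readout ρ₀ n hM (π v) f)
              (galoisCohomology.localization ((ρ₀.tateDual n).tateDual n) v 1 y)) =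
            inv ((nat y).comp (boundary (presentationComplex_shortExact ρ₀) (classBarD K)
              (f ≫ (ideleClassLimitShortComplex K).g)) (rfl : 1 + 1 = 2)))
    (hA : ∀ (n : ℕ) [NeZero n],
      ∀ ⦃M : Type⦄ [AddCommGroup M] [TopologicalSpace M] [DiscreteTopology M] [Finite M]
      (ρ₀ : DiscreteGaloisModule K M) (hM : ∀ m : M, n • m = 0),
        haveI := moduleFinite_presModule₂ ρ₀
        ∀ c ∈ shaTwo (ρ₀.tateDual n),
          cohomologyMap (dualF (presModule₂ ρ₀) ρ₀ (units K) (presProj ρ₀)) 2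
            (cohomologyMap (HomDual.tateDualUnitsIso K ρ₀ n hM).hom 2 c) = 0)
    (hB : ∀ (n : ℕ) [NeZero n],
      ∀ ⦃M : Type⦄ [AddCommGroup M] [TopologicalSpace M] [DiscreteTopology M] [Finite M]
      (ρ₀ : DiscreteGaloisModule K M),
        haveI := moduleFinite_presModule₁ ρ₀
        ∀ y : galoisCohomology (homGaloisModule (presModule₁ ρ₀) (units K)) 1,
          (∀ v : Place K, ContinuousCohomology.map (absGaloisRestrict K (Place.Completion v))
            (postcompResHom (presModule₁ ρ₀) (units K) (units (Place.Completion v)) (unitsTransfer K (Place.Completion v))) 1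
              y = 0) →
          cohomologyMap (homF (presModule₁ ρ₀) (units K) (toDGM (ideleBarD K)) (unitsToIdeleI K)) 1 y = 0) :
    poitouTate_sha_tateDual K :=
  poitouTate_sha_tateDual_of_shaTwoConnecting_real hcomp inv hT π hR3 hR4 fun n _ _ _ _ _ _ ρ₀ hM c hc =>
    exists_shaTwoConnecting_eq_of_localGlobal ρ₀ n hM (hA n ρ₀ hM) (hB n ρ₀) c hc

end LocalGlobal

end Summit.BirchSwinnertonDyer.BirchSwinnertonDyer.Theorems.PoitouTateShaTwoReadout

end
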